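/-
Copyright: the b2b-balaban T⁴-continuum CRUX team, row NE7b OWNER lineage `t4-ne7b-p1` (gen 127). Project licence.
-/
import Summits.QuantumFields.BalabanUV.T4Continuum.Spine.NE7b.SupZdCouplingWindowBase
import Summits.QuantumFields.BalabanUV.T4Continuum.Spine.NE7b.SupZdCouplingWindowCover
import Summits.QuantumFields.BalabanUV.T4Continuum.Spine.NE7b.SupZdCouplingWindowLargeMesh

/-!
# THE UNIFORM WINDOW THEOREM: on `ℤ^d` (`d ≥ 3`), for a compact window of couplings `[lo, hi]` with `0 < lo`, the road's class
# `−λ ≤ V ≤ Λ` with `λ < min(2, lo)`, and a kernel decay rate `γ > 0`, there are TWO constants `κ, δ > 0` — depending on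
# `(d, lo, hi, λ, Λ, γ)` ONLY — such that for EVERY coupling `a ∈ [lo, hi]`, EVERY mesh `n`, every potential of the class and every kernel
# `|K(p,q)| ≤ εe^{−γ|p−q|₁}` with `εκ ≤ 1`, the `H + K` column at coupling `a` has THE PACKAGE: block columns with profile `κe^{−δ|blk p − c|₁}`,
# a solution operator on `ℓ^∞(ℤ^d)` of norm `≤ κ`, uniqueness of bounded solutions, and a two-sided inverse of the coarse matrix with profile
# `κe^{−δ|b − c|₁}`; hence (255)'s composed couplings carry the package for ALL meshes `n ≥ 1` with one pair of constants — the small meshes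
# that (268) left to the compactness scheme are covered (row NE7b, node U5c; (255)∕(264)∕(266)∕(269) BY NAME; [folklore] — Heine–Borel)

Cell `pub-balaban`, sub-cell `t4`, spine estimate NE7b (`T4WeightBudget.RelWeightBound`; the cell's OWN estimate — NOT PRINTED in
[Bałaban 1983–89], NOT PROVED).  Crux-route work under `Spine/NE7b/` by the row OWNER (`t4-ne7b-p1` gen 127, file (270)) under FREEZE
(0)'s crux-prover clause, on § [NE7bP1-G126-HANDOFF] NEXT (3)(a) («the uniform window theorem (small meshes)»); NOTHING of Bałaban's is
named as a Lean object, valued or asserted; no `T4Continuum/Support` leaf typed; no `def`, no notation; zero `sorry`.  Imports (BY NAME):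
the OWNER's (269) `…SupZdCouplingWindowBase` (`road_base_package`), (266) `…SupZdCouplingWindowCover` (`exists_uniform_constant`,
`window_radius`), (268) `…SupZdCouplingWindowLargeMesh` (import closure: (264) `coupling_window_step`, (255) `zd_soft_coupling_bounds`).

WHY (located).  (269) gives the package at every single coupling `a₀ > 0` with `λ < min(2, a₀)`, uniformly in the mesh but with ten
constants OPAQUE in `a₀`; (264) moves it to every `a` with `|a − a₀|` below two thresholds; (266) §2 turns the thresholds into a radius
`ρ(a₀) > 0` once the rates are FIXED FUNCTIONS of the centre's constants (`μ₀ = min(δ₀, δ₀′, γ)∕2`, `ν₀ = min(μ₀, δ₁)∕2` — the step's radius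
depends on `K_{μ−ν}`, so free rates would give no uniform radius), and (266) §1 (Heine–Borel) picks finitely many centres.  To run the covering
on ONE real parameter the package is written in a UNIFORM SHAPE monotone in `t`: hypothesis `εt ≤ 1`, profiles `t·e^{−t⁻¹(·)}`, norm `≤ t` —
every smallness condition of (269) at the centre is `ε·X ≤ 1∕2` with `X` a function of the centre's constants, so `t ≥ 2X` suffices, and
every profile constant and rate of (264)'s output is absorbed the same way.  (268) needed two MESH thresholds; here the window
`[a(1 − 2^{−d}), a] ⊇ (a(1 − (n+1)^{−d}), a]` is compact and contains (255)'s `c_k` for every `n ≥ 1`, so no mesh is excluded.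

WHAT IS PROVED ([folklore]): §1 **`package_near_centre`** (openness: at `a₀ > 0`, `λ < min(2,a₀)`, `γ > 0`: `∃ ρ t > 0`, the uniform-shape
package at every `a` with `|a − a₀| < ρ`); §2 THE END **`uniform_window_package`** (`∃ κ δ > 0` for the whole window `[lo, hi]`); §3
**`package_along_composed_couplings_all_meshes`** ((255)'s couplings, every mesh `n ≥ 1`, every `k`, one `(κ, δ)`); §4 toy.

HONEST (what this is NOT).  Compactness + bookkeeping over (264)∕(266)∕(269) by name — no new estimate; the constants are EXISTENTIAL
(a finite maximum over unnamed centres) and depend on the kernel rate `γ`; the output rate `δ` is some positive number below the centres'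
rates (no value); `d ≥ 3` and the road's class only; scalar skeleton ((A3), NC-NE7b-α UNRULED); nothing of the torus; nothing of the
covariant propagators of [B4]–[B6]; nothing of Bałaban's asserted.  BY-NAME EFFECT ON THE WALL: NONE.  NE7b NOT PRINTED ∕ NOT PROVED; spine
PROVED 0∕9; rung (B)+1 — the programme's measures remain FINITE-torus statements; NOT the mass gap, NOT Clay.  HONEST DEPENDENCY: continuum
YM on T⁴ ⇐ BetaPertH ∧ nine spine estimates (0∕9 proved); BetaPertH ⇐ (D1) ∧ (D4) ∧ CAP+tail; G-an2-4 gates asym, D1 and NE2∕3∕4.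
-/

set_option autoImplicit false

noncomputable section

namespace Summit.QuantumFields.BalabanUV.T4Continuum.NE7b.SupZdCouplingWindowUniform

open Real Filter Topology
open scoped ENNReal
open Literature.MathematicalPhysics.QuantumFieldTheory.Balaban1983to89
open B6QGQLower276 (X e blk B mem_B sum_B_const)
open SupZdCouplingWindowBase (road_base_package)
open SupZdCouplingWindowCover (exists_uniform_constant window_radius)
open SupZdCouplingWindowStep (coupling_window_step)
open SupZdSoftStepCouplings (zd_soft_coupling_bounds)

variable {d : ℕ}

/-! ## §0. Arithmetic of the uniform shape -/

/-- The geometric-sum factor `K_s = (2(1 − e^{−s})⁻¹)^d` of (264)∕(269) is nonnegative for a nonnegative rate gap `s`. -/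
private theorem kA_nonneg (d : ℕ) {s : ℝ} (hs : 0 ≤ s) : 0 ≤ (2 * (1 - exp (-s))⁻¹) ^ d :=
  pow_nonneg (mul_nonneg zero_le_two (inv_nonneg.2 (sub_nonneg.2 (exp_le_one_iff.2 (by linarith))))) d

/-- A smallness condition `εX ≤ 1∕2` follows from `εt ≤ 1` once `2X ≤ t`. -/
private theorem small_of_le {ε t X : ℝ} (hε : 0 ≤ ε) (hεt : ε * t ≤ 1) (hXt : 2 * X ≤ t) :
    ε * X ≤ 1 / 2 := by nlinarith

/-- A profile `Ce^{−rS}` is below `te^{−t⁻¹S}` once `C ≤ t` and `t⁻¹ ≤ r` (`S ≥ 0`). -/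
private theorem profile_le {C r t S : ℝ} (hCt : C ≤ t) (hrt : t⁻¹ ≤ r) (ht : 0 ≤ t) (hS : 0 ≤ S) :
    C * exp (-(r * S)) ≤ t * exp (-(t⁻¹ * S)) :=
  mul_le_mul hCt (exp_le_exp.2 (neg_le_neg (mul_le_mul_of_nonneg_right hrt hS))) (exp_pos _).le ht

/-! ## §1. Openness: the uniform-shape package near every admissible centre -/

/-- **THE PACKAGE NEAR A CENTRE.**  `d ≥ 3`, `a₀ > 0`, `λ < min(2, a₀)`, `Λ ≥ 0`, `γ > 0` ⟹ `∃ ρ t > 0` such that at EVERY coupling `a` with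
`|a − a₀| < ρ`, for every mesh `n`, potential `−λ ≤ V ≤ Λ`, `ε ≥ 0` with `εt ≤ 1` and kernel `|K(p,q)| ≤ εe^{−γ|p−q|₁}`: `∃ Ψ G N` — block columns
with profile `te^{−t⁻¹|blk p − c|₁}` solving the `a`-equations, `G ∈ L(ℓ^∞)` with `‖Gf‖ ≤ t‖f‖` solving the `a`-equation, uniqueness of bounded
solutions at `a`, and `N` with profile `te^{−t⁻¹|b − c|₁}`, `T_aN = 1 = NT_a` (absolutely convergent) — (269) at `a₀` with fixed rates, (264) to
`a`, (266) §2 for the radius. [folklore] -/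
theorem package_near_centre (hd : 3 ≤ d) (a₀ : ℝ) (ha₀ : 0 < a₀) {lam Lam γ : ℝ} (hlam : lam < min 2 a₀) (hLam : 0 ≤ Lam)
    (hγ : 0 < γ) :
    ∃ ρ t : ℝ, 0 < ρ ∧ 0 < t ∧ ∀ a : ℝ, |a - a₀| < ρ →
    ∀ (n : ℕ) (V : X d → ℝ), (∀ p, -lam ≤ V p) → (∀ p, V p ≤ Lam) → ∀ ε : ℝ, 0 ≤ ε → ε * t ≤ 1 →
    ∀ (K : X d → X d → ℝ), (∀ p q, |K p q| ≤ ε * exp (-(γ * ∑ i, (((p i - q i).natAbs : ℕ) : ℝ)))) →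
    ∃ (Ψ : X d → X d → ℝ) (G : lp (fun _ : X d => ℝ) ∞ →L[ℝ] lp (fun _ : X d => ℝ) ∞) (N : X d → X d → ℝ),
      (∀ c p, |Ψ c p| ≤ t * exp (-(t⁻¹ * ∑ i, (((blk n p i - c i).natAbs : ℕ) : ℝ)))) ∧
      (∀ c p, ((n : ℝ) + 1) ^ 2 * ∑ μ', (2 * Ψ c p - Ψ c (p + e μ') - Ψ c (p - e μ'))
        + a / ((n : ℝ) + 1) ^ d * ∑ q ∈ B n (blk n p), Ψ c q + V p * Ψ c p + ∑' q : X d, K p q * Ψ c q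
          = if blk n p = c then 1 else 0) ∧
      (∀ f : lp (fun _ : X d => ℝ) ∞, ‖G f‖ ≤ t * ‖f‖) ∧
      (∀ (f : lp (fun _ : X d => ℝ) ∞) (p : X d),
        ((n : ℝ) + 1) ^ 2 * ∑ μ', (2 * G f p - G f (p + e μ') - G f (p - e μ'))
          + a / ((n : ℝ) + 1) ^ d * ∑ q ∈ B n (blk n p), G f q + V p * G f p + ∑' q : X d, K p q * G f q = f p) ∧
      (∀ (f : X d → ℝ) (Mf : ℝ), (∀ p, |f p| ≤ Mf) → ∀ (u v : X d → ℝ) (Bu Bv : ℝ), (∀ p, |u p| ≤ Bu) → (∀ p, |v p| ≤ Bv) →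
        (∀ p, ((n : ℝ) + 1) ^ 2 * ∑ μ', (2 * u p - u (p + e μ') - u (p - e μ'))
          + a / ((n : ℝ) + 1) ^ d * ∑ q ∈ B n (blk n p), u q + V p * u p + ∑' q : X d, K p q * u q = f p) →
        (∀ p, ((n : ℝ) + 1) ^ 2 * ∑ μ', (2 * v p - v (p + e μ') - v (p - e μ'))
          + a / ((n : ℝ) + 1) ^ d * ∑ q ∈ B n (blk n p), v q + V p * v p + ∑' q : X d, K p q * v q = f p) →
        ∀ p, u p = v p) ∧
      (∀ b c, |N b c| ≤ t * exp (-(t⁻¹ * ∑ i, (((b i - c i).natAbs : ℕ) : ℝ)))) ∧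
      (∀ b c', Summable (fun c : X d => ((((n : ℝ) + 1) ^ d)⁻¹ * ∑ q ∈ B n b, Ψ c q) * N c c') ∧
        ∑' c : X d, ((((n : ℝ) + 1) ^ d)⁻¹ * ∑ q ∈ B n b, Ψ c q) * N c c' = if b = c' then 1 else 0) ∧
      (∀ c b, Summable (fun b' : X d => N c b' * ((((n : ℝ) + 1) ^ d)⁻¹ * ∑ q ∈ B n b', Ψ b q)) ∧
        ∑' b' : X d, N c b' * ((((n : ℝ) + 1) ^ d)⁻¹ * ∑ q ∈ B n b', Ψ b q) = if c = b then 1 else 0) := by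
  classical
  obtain ⟨C₀, CP, δ₀, c₁, δ₁, C₀', CP', δ₀', -, CG, hC₀, hCP, hδ₀, hc₁, hδ₁, hC₀', hCP', hδ₀', -, hCG, H⟩ :=
    road_base_package hd a₀ ha₀ hlam hLam
  -- the rates, fixed functions of the centre's constants and of `γ`
  obtain ⟨μ₀, hμ₀⟩ : ∃ x : ℝ, x = min (min δ₀ δ₀') γ / 2 := ⟨_, rfl⟩
  have hm₁ := min_le_left (min δ₀ δ₀') γ
  have hm₂ := min_le_right (min δ₀ δ₀') γ
  have hm₃ := min_le_left δ₀ δ₀'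
  have hm₄ := min_le_right δ₀ δ₀'
  have hm₀ : 0 < min (min δ₀ δ₀') γ := by positivity
  have hμ₀pos : 0 < μ₀ := by rw [hμ₀]; positivity
  have hμ₀δ₀ : μ₀ < δ₀ := by rw [hμ₀]; linarith
  have hμ₀δ₀' : μ₀ < δ₀' := by rw [hμ₀]; linarith
  have hμ₀γ : μ₀ < γ := by rw [hμ₀]; linarith
  obtain ⟨ν₀, hν₀⟩ : ∃ x : ℝ, x = min μ₀ δ₁ / 2 := ⟨_, rfl⟩
  have hm₅ := min_le_left μ₀ δ₁
  have hm₆ := min_le_right μ₀ δ₁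
  have hm₇ : 0 < min μ₀ δ₁ := by positivity
  have hν₀pos : 0 < ν₀ := by rw [hν₀]; positivity
  have hν₀μ₀ : ν₀ < μ₀ := by rw [hν₀]; linarith
  have hν₀δ₁ : ν₀ < δ₁ := by rw [hν₀]; linarith
  -- the geometric-sum factors and exponentials at these rates, as named nonnegative reals
  obtain ⟨Kγ, hKγ0, hKγ⟩ : ∃ x : ℝ, 0 ≤ x ∧ x = (2 * (1 - exp (-γ))⁻¹) ^ d := ⟨_, kA_nonneg d hγ.le, rfl⟩
  obtain ⟨Kδμ, hKδμ0, hKδμ⟩ : ∃ x : ℝ, 0 ≤ x ∧ x = (2 * (1 - exp (-(δ₀ - μ₀)))⁻¹) ^ d :=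
    ⟨_, kA_nonneg d (by linarith), rfl⟩
  obtain ⟨Kγμ, hKγμ0, hKγμ⟩ : ∃ x : ℝ, 0 ≤ x ∧ x = (2 * (1 - exp (-(γ - μ₀)))⁻¹) ^ d :=
    ⟨_, kA_nonneg d (by linarith), rfl⟩
  obtain ⟨Kδν, hKδν0, hKδν⟩ : ∃ x : ℝ, 0 ≤ x ∧ x = (2 * (1 - exp (-(δ₁ - ν₀)))⁻¹) ^ d :=
    ⟨_, kA_nonneg d (by linarith), rfl⟩
  obtain ⟨Kμν, hKμν0, hKμν⟩ : ∃ x : ℝ, 0 ≤ x ∧ x = (2 * (1 - exp (-(μ₀ - ν₀)))⁻¹) ^ d :=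
    ⟨_, kA_nonneg d (by linarith), rfl⟩
  obtain ⟨Kδμ', hKδμ'0, hKδμ'⟩ : ∃ x : ℝ, 0 ≤ x ∧ x = (2 * (1 - exp (-(δ₀' - μ₀)))⁻¹) ^ d :=
    ⟨_, kA_nonneg d (by linarith), rfl⟩
  obtain ⟨K₁, hK₁0, hK₁⟩ : ∃ x : ℝ, 0 ≤ x ∧ x = (2 * (1 - exp (-1))⁻¹) ^ d := ⟨_, kA_nonneg d zero_le_one, rfl⟩
  obtain ⟨Eμ, hEμ0, hEμ⟩ : ∃ x : ℝ, 0 ≤ x ∧ x = exp (μ₀ * d) := ⟨_, (exp_pos _).le, rfl⟩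
  obtain ⟨Eν, hEν0, hEν⟩ : ∃ x : ℝ, 0 ≤ x ∧ x = exp (ν₀ * d) := ⟨_, (exp_pos _).le, rfl⟩
  -- the radius of the window step at the centre ((266) §2), for the centre's column constant `2C_PK_{δ₀−μ₀}` and `2C_G`
  obtain ⟨ρ, hρ, hρth⟩ :=
    window_radius d (μ := μ₀) (ν := ν₀) (CΨ := 2 * (CP * Kδμ)) (CG := 2 * CG) hν₀μ₀ (by positivity) (by positivity)
  -- the one constant
  obtain ⟨t, ht⟩ : ∃ t : ℝ, t = ν₀⁻¹ + 2 * (Eν * K₁) * (2 * (CP * Kδμ)) * Kμν + 4 * CG + (2 * (c₁ * Eν * Kδν) + ρ)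
      + 2 * (Kγ * C₀ + CP * Kδμ * Eμ * Kγμ
        + c₁ * Eν * Kδν * (4 * (CP * Kδμ) * (CP * Kδμ * (Eμ * Kγμ))) * Eν * Kμν
        + Kγ * C₀' + CP' * Kδμ' * Eμ * Kγμ + Kγ * CG) := ⟨_, rfl⟩
  have hν₀i : 0 ≤ ν₀⁻¹ := inv_nonneg.2 hν₀pos.le
  have hX1 : 0 ≤ Kγ * C₀ := by positivity
  have hX2 : 0 ≤ CP * Kδμ * Eμ * Kγμ := by positivity
  have hX3 : 0 ≤ c₁ * Eν * Kδν * (4 * (CP * Kδμ) * (CP * Kδμ * (Eμ * Kγμ))) * Eν * Kμν := by positivity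
  have hX4 : 0 ≤ Kγ * C₀' := by positivity
  have hX5 : 0 ≤ CP' * Kδμ' * Eμ * Kγμ := by positivity
  have hX6 : 0 ≤ Kγ * CG := by positivity
  have hP1 : 0 ≤ 2 * (Eν * K₁) * (2 * (CP * Kδμ)) * Kμν := by positivity
  have hP4 : 0 ≤ 2 * (c₁ * Eν * Kδν) := by positivity
  have htpos : 0 < t := by rw [ht]; positivity
  have htν : t⁻¹ ≤ ν₀ := inv_le_of_inv_le₀ hν₀pos (by rw [ht]; linarith)
  refine ⟨ρ, t, hρ, htpos, fun a ha n V hV hV' ε hε hεt K hK => ?_⟩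
  have hS : ∀ b c : X d, (0 : ℝ) ≤ ∑ i, (((b i - c i).natAbs : ℕ) : ℝ) := fun _ _ => by positivity
  obtain ⟨hs1, hs2⟩ := hρth a₀ a ha
  -- the base package at the centre ((269)), every smallness condition from `εt ≤ 1`
  obtain ⟨Ψ, G, N, hΨd, hΨ, hGn, hG, hU, hNd, hTN, hNT⟩ := H n V hV hV' ε γ μ₀ ν₀ hε hμ₀pos hμ₀δ₀ hμ₀γ hν₀pos hν₀μ₀ hν₀δ₁
    (by
      rw [← hKγ, (by ring : ε * Kγ * C₀ = ε * (Kγ * C₀))]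
      exact small_of_le hε hεt (by rw [ht]; linarith))
    (by
      rw [← hKδμ, ← hEμ, ← hKγμ, (by ring : CP * Kδμ * (ε * Eμ * Kγμ) = ε * (CP * Kδμ * Eμ * Kγμ))]
      exact small_of_le hε hεt (by rw [ht]; linarith))
    (by
      rw [← hKδμ, ← hEμ, ← hKγμ, ← hEν, ← hKδν, ← hKμν, (by ring :
        c₁ * Eν * Kδν * (4 * (CP * Kδμ) * (CP * Kδμ * (ε * Eμ * Kγμ)) * Eν * Kμν)
          = ε * (c₁ * Eν * Kδν * (4 * (CP * Kδμ) * (CP * Kδμ * (Eμ * Kγμ))) * Eν * Kμν))]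
      exact small_of_le hε hεt (by rw [ht]; linarith))
    hμ₀δ₀'
    (by
      rw [← hKγ, (by ring : ε * Kγ * C₀' = ε * (Kγ * C₀'))]
      exact small_of_le hε hεt (by rw [ht]; linarith))
    (by
      rw [← hKδμ', ← hEμ, ← hKγμ, (by ring : CP' * Kδμ' * (ε * Eμ * Kγμ) = ε * (CP' * Kδμ' * Eμ * Kγμ))]
      exact small_of_le hε hεt (by rw [ht]; linarith))
    (by
      rw [← hKγ, (by ring : ε * Kγ * CG = ε * (Kγ * CG))]
      exact small_of_le hε hεt (by rw [ht]; linarith))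
    K hK
  rw [← hKδμ] at hΨd
  rw [← hEν, ← hKδν] at hNd
  -- the window step from `a₀` to `a` ((264)), auxiliary rate `ν₀∕2`
  obtain ⟨Ψ', G', hΨ'd, hΨ', hG'n, hG', hU', hR, hL⟩ :=
    coupling_window_step n a₀ a hε hγ (half_pos hν₀pos) (half_lt_self hν₀pos) hν₀μ₀ hν₀pos V K hK Ψ hΨd hΨ G hGn hG
      hU N hNd hTN hNT hs1 hs2
  rw [← hEν, ← hK₁, ← hKμν] at hΨ'd
  refine ⟨Ψ', G', fun b c => N b c + (a - a₀) * (if b = c then 1 else 0), fun c p => ?_, hΨ', fun f => ?_, hG', hU',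
    fun b c => ?_, hR, hL⟩
  · -- (P1) the column profile
    exact (hΨ'd c p).trans (profile_le (by rw [ht]; linarith) htν htpos.le (hS _ _))
  · -- (P2) the solution operator's norm
    exact (hG'n f).trans (mul_le_mul_of_nonneg_right (by rw [ht]; linarith) (norm_nonneg _))
  · -- (P4) the shifted inverse's profile
    show |N b c + (a - a₀) * (if b = c then 1 else 0)| ≤ _
    by_cases hbc : b = c
    · subst hbc
      have h0 : ∑ i, (((b i - b i).natAbs : ℕ) : ℝ) = 0 := by simp
      rw [if_pos rfl, mul_one, h0, mul_zero, neg_zero, exp_zero, mul_one]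
      have h1 := hNd b b
      rw [h0, mul_zero, neg_zero, exp_zero, mul_one] at h1
      have h2 : |a - a₀| ≤ ρ := ha.le
      calc |N b b + (a - a₀)| ≤ |N b b| + |a - a₀| := abs_add_le _ _
        _ ≤ t := by rw [ht]; linarith
    · rw [if_neg hbc, mul_zero, add_zero]
      exact (hNd b c).trans (profile_le (by rw [ht]; linarith [abs_nonneg (a - a₀)]) htν htpos.le (hS _ _))

/-! ## §2. THE END: one pair of constants on the whole window -/

/-- **HEADLINE — THE UNIFORM WINDOW THEOREM.**  `d ≥ 3`, `0 < lo ≤ hi`, `λ < min(2, lo)`, `Λ ≥ 0`, `γ > 0` ⟹ `∃ κ δ > 0` (functions of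
`(d, lo, hi, λ, Λ, γ)` only) such that at EVERY coupling `a ∈ [lo, hi]`, for every mesh `n`, potential `−λ ≤ V ≤ Λ`, `ε ≥ 0` with `εκ ≤ 1` and
kernel `|K(p,q)| ≤ εe^{−γ|p−q|₁}`: `∃ Ψ G N` — block columns with profile `κe^{−δ|blk p − c|₁}` solving the `a`-equations, `G ∈ L(ℓ^∞(ℤ^d))` with
`‖Gf‖ ≤ κ‖f‖` solving the `a`-equation, uniqueness of bounded solutions at `a`, and a two-sided inverse `N` of the coarse matrix
`T_a(b,c) = (n+1)^{−d}Σ_{B b}Ψ_c` with profile `κe^{−δ|b − c|₁}` (absolutely convergent products) — §1 at every centre + (266) §1. [folklore] -/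
theorem uniform_window_package (hd : 3 ≤ d) {lo hi lam Lam γ : ℝ} (hlo : 0 < lo) (hlohi : lo ≤ hi) (hlam : lam < min 2 lo)
    (hLam : 0 ≤ Lam) (hγ : 0 < γ) :
    ∃ κ δ : ℝ, 0 < κ ∧ 0 < δ ∧ ∀ a ∈ Set.Icc lo hi,
    ∀ (n : ℕ) (V : X d → ℝ), (∀ p, -lam ≤ V p) → (∀ p, V p ≤ Lam) → ∀ ε : ℝ, 0 ≤ ε → ε * κ ≤ 1 →
    ∀ (K : X d → X d → ℝ), (∀ p q, |K p q| ≤ ε * exp (-(γ * ∑ i, (((p i - q i).natAbs : ℕ) : ℝ)))) →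
    ∃ (Ψ : X d → X d → ℝ) (G : lp (fun _ : X d => ℝ) ∞ →L[ℝ] lp (fun _ : X d => ℝ) ∞) (N : X d → X d → ℝ),
      (∀ c p, |Ψ c p| ≤ κ * exp (-(δ * ∑ i, (((blk n p i - c i).natAbs : ℕ) : ℝ)))) ∧
      (∀ c p, ((n : ℝ) + 1) ^ 2 * ∑ μ', (2 * Ψ c p - Ψ c (p + e μ') - Ψ c (p - e μ'))
        + a / ((n : ℝ) + 1) ^ d * ∑ q ∈ B n (blk n p), Ψ c q + V p * Ψ c p + ∑' q : X d, K p q * Ψ c q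
          = if blk n p = c then 1 else 0) ∧
      (∀ f : lp (fun _ : X d => ℝ) ∞, ‖G f‖ ≤ κ * ‖f‖) ∧
      (∀ (f : lp (fun _ : X d => ℝ) ∞) (p : X d),
        ((n : ℝ) + 1) ^ 2 * ∑ μ', (2 * G f p - G f (p + e μ') - G f (p - e μ'))
          + a / ((n : ℝ) + 1) ^ d * ∑ q ∈ B n (blk n p), G f q + V p * G f p + ∑' q : X d, K p q * G f q = f p) ∧
      (∀ (f : X d → ℝ) (Mf : ℝ), (∀ p, |f p| ≤ Mf) → ∀ (u v : X d → ℝ) (Bu Bv : ℝ), (∀ p, |u p| ≤ Bu) → (∀ p, |v p| ≤ Bv) →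
        (∀ p, ((n : ℝ) + 1) ^ 2 * ∑ μ', (2 * u p - u (p + e μ') - u (p - e μ'))
          + a / ((n : ℝ) + 1) ^ d * ∑ q ∈ B n (blk n p), u q + V p * u p + ∑' q : X d, K p q * u q = f p) →
        (∀ p, ((n : ℝ) + 1) ^ 2 * ∑ μ', (2 * v p - v (p + e μ') - v (p - e μ'))
          + a / ((n : ℝ) + 1) ^ d * ∑ q ∈ B n (blk n p), v q + V p * v p + ∑' q : X d, K p q * v q = f p) →
        ∀ p, u p = v p) ∧
      (∀ b c, |N b c| ≤ κ * exp (-(δ * ∑ i, (((b i - c i).natAbs : ℕ) : ℝ)))) ∧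
      (∀ b c', Summable (fun c : X d => ((((n : ℝ) + 1) ^ d)⁻¹ * ∑ q ∈ B n b, Ψ c q) * N c c') ∧
        ∑' c : X d, ((((n : ℝ) + 1) ^ d)⁻¹ * ∑ q ∈ B n b, Ψ c q) * N c c' = if b = c' then 1 else 0) ∧
      (∀ c b, Summable (fun b' : X d => N c b' * ((((n : ℝ) + 1) ^ d)⁻¹ * ∑ q ∈ B n b', Ψ b q)) ∧
        ∑' b' : X d, N c b' * ((((n : ℝ) + 1) ^ d)⁻¹ * ∑ q ∈ B n b', Ψ b q) = if c = b then 1 else 0) := by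
  classical
  refine (exists_uniform_constant (lo := lo) (hi := hi) (fun a t => 0 < t ∧
    ∀ (n : ℕ) (V : X d → ℝ), (∀ p, -lam ≤ V p) → (∀ p, V p ≤ Lam) → ∀ ε : ℝ, 0 ≤ ε → ε * t ≤ 1 →
    ∀ (K : X d → X d → ℝ), (∀ p q, |K p q| ≤ ε * exp (-(γ * ∑ i, (((p i - q i).natAbs : ℕ) : ℝ)))) →
    ∃ (Ψ : X d → X d → ℝ) (G : lp (fun _ : X d => ℝ) ∞ →L[ℝ] lp (fun _ : X d => ℝ) ∞) (N : X d → X d → ℝ),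
      (∀ c p, |Ψ c p| ≤ t * exp (-(t⁻¹ * ∑ i, (((blk n p i - c i).natAbs : ℕ) : ℝ)))) ∧
      (∀ c p, ((n : ℝ) + 1) ^ 2 * ∑ μ', (2 * Ψ c p - Ψ c (p + e μ') - Ψ c (p - e μ'))
        + a / ((n : ℝ) + 1) ^ d * ∑ q ∈ B n (blk n p), Ψ c q + V p * Ψ c p + ∑' q : X d, K p q * Ψ c q
          = if blk n p = c then 1 else 0) ∧
      (∀ f : lp (fun _ : X d => ℝ) ∞, ‖G f‖ ≤ t * ‖f‖) ∧
      (∀ (f : lp (fun _ : X d => ℝ) ∞) (p : X d),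
        ((n : ℝ) + 1) ^ 2 * ∑ μ', (2 * G f p - G f (p + e μ') - G f (p - e μ'))
          + a / ((n : ℝ) + 1) ^ d * ∑ q ∈ B n (blk n p), G f q + V p * G f p + ∑' q : X d, K p q * G f q = f p) ∧
      (∀ (f : X d → ℝ) (Mf : ℝ), (∀ p, |f p| ≤ Mf) → ∀ (u v : X d → ℝ) (Bu Bv : ℝ), (∀ p, |u p| ≤ Bu) → (∀ p, |v p| ≤ Bv) →
        (∀ p, ((n : ℝ) + 1) ^ 2 * ∑ μ', (2 * u p - u (p + e μ') - u (p - e μ'))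
          + a / ((n : ℝ) + 1) ^ d * ∑ q ∈ B n (blk n p), u q + V p * u p + ∑' q : X d, K p q * u q = f p) →
        (∀ p, ((n : ℝ) + 1) ^ 2 * ∑ μ', (2 * v p - v (p + e μ') - v (p - e μ'))
          + a / ((n : ℝ) + 1) ^ d * ∑ q ∈ B n (blk n p), v q + V p * v p + ∑' q : X d, K p q * v q = f p) →
        ∀ p, u p = v p) ∧
      (∀ b c, |N b c| ≤ t * exp (-(t⁻¹ * ∑ i, (((b i - c i).natAbs : ℕ) : ℝ)))) ∧
      (∀ b c', Summable (fun c : X d => ((((n : ℝ) + 1) ^ d)⁻¹ * ∑ q ∈ B n b, Ψ c q) * N c c') ∧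
        ∑' c : X d, ((((n : ℝ) + 1) ^ d)⁻¹ * ∑ q ∈ B n b, Ψ c q) * N c c' = if b = c' then 1 else 0) ∧
      (∀ c b, Summable (fun b' : X d => N c b' * ((((n : ℝ) + 1) ^ d)⁻¹ * ∑ q ∈ B n b', Ψ b q)) ∧
        ∑' b' : X d, N c b' * ((((n : ℝ) + 1) ^ d)⁻¹ * ∑ q ∈ B n b', Ψ b q) = if c = b then 1 else 0))
    ?_ ?_).elim fun t ht => ?_
  · -- the uniform shape is monotone in `t`
    rintro a t t' ⟨htpos, h⟩ htt'
    refine ⟨htpos.trans_le htt', fun n V hV hV' ε hε hεt K hK => ?_⟩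
    obtain ⟨Ψ, G, N, hΨd, hΨ, hGn, hG, hU, hNd, hTN, hNT⟩ :=
      h n V hV hV' ε hε ((mul_le_mul_of_nonneg_left htt' hε).trans hεt) K hK
    have ht'pos : 0 < t' := htpos.trans_le htt'
    have hinv : t'⁻¹ ≤ t⁻¹ := inv_anti₀ htpos htt'
    exact ⟨Ψ, G, N, fun c p => (hΨd c p).trans (profile_le htt' hinv ht'pos.le (by positivity)), hΨ,
      fun f => (hGn f).trans (mul_le_mul_of_nonneg_right htt' (norm_nonneg _)), hG, hU,
      fun b c => (hNd b c).trans (profile_le htt' hinv ht'pos.le (by positivity)), hTN, hNT⟩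
  · -- §1 at every centre of the window
    intro a₀ ha₀
    have hlam₀ : lam < min 2 a₀ := lt_of_lt_of_le hlam (min_le_min le_rfl ha₀.1)
    obtain ⟨ρ, t, hρ, ht, h⟩ := package_near_centre hd a₀ (hlo.trans_le ha₀.1) hlam₀ hLam hγ
    exact ⟨ρ, t, hρ, fun a ha => ⟨ht, h a ha⟩⟩
  · have h0 := (ht lo ⟨le_rfl, hlohi⟩).1
    exact ⟨t, t⁻¹, h0, inv_pos.2 h0, fun a ha => (ht a ha).2⟩

/-! ## §3. (255)'s composed couplings, every mesh -/

/-- **THE PACKAGE ALONG (255)'s COMPOSED COUPLINGS, ALL MESHES.**  `d ≥ 3`, `a > 0`, `λ < min(2, a(1 − 2^{−d}))`, `Λ ≥ 0`, `γ > 0` ⟹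
`∃ κ δ > 0` such that for EVERY mesh `n ≥ 1`, the composed couplings `c_0 = a`, `c_{k+1} = c_ka(n+1)^d∕(c_k(n+1)^d + a)` and EVERY `k`: the
package of §2 holds at coupling `c_k` and mesh `n` with the constants `(κ, δ)` — independent of `n` and `k` ((255): `c_k ∈ (a(1 − (n+1)^{−d}), a]
⊆ [a(1 − 2^{−d}), a]`; §2 on that window).  The large meshes of (268) and the small ones at once. [folklore] -/
theorem package_along_composed_couplings_all_meshes (hd : 3 ≤ d) (a : ℝ) (ha : 0 < a) {lam Lam γ : ℝ}
    (hlam : lam < min 2 (a * (1 - ((2 : ℝ) ^ d)⁻¹))) (hLam : 0 ≤ Lam) (hγ : 0 < γ) :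
    ∃ κ δ : ℝ, 0 < κ ∧ 0 < δ ∧ ∀ (n : ℕ), 1 ≤ n → ∀ (cs : ℕ → ℝ), cs 0 = a →
    (∀ k, cs (k + 1) = cs k * a * ((n : ℝ) + 1) ^ d / (cs k * ((n : ℝ) + 1) ^ d + a)) → ∀ (k : ℕ),
    ∀ (V : X d → ℝ), (∀ p, -lam ≤ V p) → (∀ p, V p ≤ Lam) → ∀ ε : ℝ, 0 ≤ ε → ε * κ ≤ 1 →
    ∀ (K : X d → X d → ℝ), (∀ p q, |K p q| ≤ ε * exp (-(γ * ∑ i, (((p i - q i).natAbs : ℕ) : ℝ)))) →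
    ∃ (Ψ : X d → X d → ℝ) (G : lp (fun _ : X d => ℝ) ∞ →L[ℝ] lp (fun _ : X d => ℝ) ∞) (N : X d → X d → ℝ),
      (∀ c p, |Ψ c p| ≤ κ * exp (-(δ * ∑ i, (((blk n p i - c i).natAbs : ℕ) : ℝ)))) ∧
      (∀ c p, ((n : ℝ) + 1) ^ 2 * ∑ μ', (2 * Ψ c p - Ψ c (p + e μ') - Ψ c (p - e μ'))
        + cs k / ((n : ℝ) + 1) ^ d * ∑ q ∈ B n (blk n p), Ψ c q + V p * Ψ c p + ∑' q : X d, K p q * Ψ c q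
          = if blk n p = c then 1 else 0) ∧
      (∀ f : lp (fun _ : X d => ℝ) ∞, ‖G f‖ ≤ κ * ‖f‖) ∧
      (∀ (f : lp (fun _ : X d => ℝ) ∞) (p : X d),
        ((n : ℝ) + 1) ^ 2 * ∑ μ', (2 * G f p - G f (p + e μ') - G f (p - e μ'))
          + cs k / ((n : ℝ) + 1) ^ d * ∑ q ∈ B n (blk n p), G f q + V p * G f p + ∑' q : X d, K p q * G f q = f p) ∧
      (∀ (f : X d → ℝ) (Mf : ℝ), (∀ p, |f p| ≤ Mf) → ∀ (u v : X d → ℝ) (Bu Bv : ℝ), (∀ p, |u p| ≤ Bu) → (∀ p, |v p| ≤ Bv) →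
        (∀ p, ((n : ℝ) + 1) ^ 2 * ∑ μ', (2 * u p - u (p + e μ') - u (p - e μ'))
          + cs k / ((n : ℝ) + 1) ^ d * ∑ q ∈ B n (blk n p), u q + V p * u p + ∑' q : X d, K p q * u q = f p) →
        (∀ p, ((n : ℝ) + 1) ^ 2 * ∑ μ', (2 * v p - v (p + e μ') - v (p - e μ'))
          + cs k / ((n : ℝ) + 1) ^ d * ∑ q ∈ B n (blk n p), v q + V p * v p + ∑' q : X d, K p q * v q = f p) →
        ∀ p, u p = v p) ∧
      (∀ b c, |N b c| ≤ κ * exp (-(δ * ∑ i, (((b i - c i).natAbs : ℕ) : ℝ)))) ∧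
      (∀ b c', Summable (fun c : X d => ((((n : ℝ) + 1) ^ d)⁻¹ * ∑ q ∈ B n b, Ψ c q) * N c c') ∧
        ∑' c : X d, ((((n : ℝ) + 1) ^ d)⁻¹ * ∑ q ∈ B n b, Ψ c q) * N c c' = if b = c' then 1 else 0) ∧
      (∀ c b, Summable (fun b' : X d => N c b' * ((((n : ℝ) + 1) ^ d)⁻¹ * ∑ q ∈ B n b', Ψ b q)) ∧
        ∑' b' : X d, N c b' * ((((n : ℝ) + 1) ^ d)⁻¹ * ∑ q ∈ B n b', Ψ b q) = if c = b then 1 else 0) := by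
  have hd1 : 1 ≤ d := le_trans (by norm_num) hd
  have h2d : (1 : ℝ) < (2 : ℝ) ^ d := one_lt_pow₀ one_lt_two (by omega)
  have hlo : 0 < a * (1 - ((2 : ℝ) ^ d)⁻¹) := mul_pos ha (sub_pos.2 (inv_lt_one_of_one_lt₀ h2d))
  have hlohi : a * (1 - ((2 : ℝ) ^ d)⁻¹) ≤ a := by
    have : 0 ≤ a * ((2 : ℝ) ^ d)⁻¹ := by positivity
    nlinarith
  obtain ⟨κ, δ, hκ, hδ, H⟩ := uniform_window_package hd hlo hlohi hlam hLam hγ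
  refine ⟨κ, δ, hκ, hδ, fun n hn cs h0 hsucc k => ?_⟩
  -- `c_k` lies in the compact window
  obtain ⟨hlow, hhigh, -⟩ := zd_soft_coupling_bounds hd1 n hn ha cs h0 hsucc k
  have hmesh : (2 : ℝ) ^ d ≤ ((n : ℝ) + 1) ^ d :=
    pow_le_pow_left₀ zero_le_two (by have h1 : (1 : ℝ) ≤ n := (by exact_mod_cast hn); linarith) d
  have hwin : a * (1 - ((2 : ℝ) ^ d)⁻¹) ≤ cs k := by
    have hi : (((n : ℝ) + 1) ^ d)⁻¹ ≤ ((2 : ℝ) ^ d)⁻¹ := inv_anti₀ (by positivity) hmesh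
    nlinarith
  exact H (cs k) ⟨hwin, hhigh⟩ n

/-! ## §4. Toy -/

/-- Toy (`d = 3`, window `[1, 2]`, `λ = 0`, `Λ = 1`, `γ = 1`): the two uniform constants exist. -/
example : ∃ κ δ : ℝ, 0 < κ ∧ 0 < δ :=
  let ⟨κ, δ, hκ, hδ, _⟩ :=
    uniform_window_package (d := 3) le_rfl (lo := 1) (hi := 2) (lam := 0) (Lam := 1) (γ := 1) one_pos (by norm_num)
      (by rw [min_eq_right (by norm_num : (1 : ℝ) ≤ 2)]; norm_num) zero_le_one one_pos
  ⟨κ, δ, hκ, hδ⟩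

end Summit.QuantumFields.BalabanUV.T4Continuum.NE7b.SupZdCouplingWindowUniform
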